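import Summits.ABC.StewartYu.PadicG3SatRecord
import Summits.ABC.StewartYu.SatBoxCount
import HarnessLib

/-!
# Cell abc-stewartyu, WP-L.P(odd) (crux r3 `PadicCoreOddRat`, stmt-ABC-20503): the COUNT of the skew family of the saturated START
# (`#satFam ≥ N·∏(2·sⱼ)` under the index identity `N = |det C|` — p1's `SatBox.card_satBox_ge` in the frame's letters)

`Summits/ABC/StewartYu/PadicG3SatNCount.lean` — cell `abc-stewartyu` (seat p2-g6; pack twin, B1 count).  Proofs only; no definition, no named fact.

* `card_satFam_ge_of_det`: for `F : S.SatData` with `(F.N : ℤ) = |F.C.det|` and any schedule `Sc`,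
  `F.N · ∏ⱼ (2·sideS₂ Sc j) ≤ #satFam F (LcS F Sc) (svS F Sc)`;
* `startCountSat_of_record`: the B1 conjunct of `IneqPackSat S F Sc` from a record-side count
  `2·#(nodes × orders)·((p−1)·p^m) ≤ (L₀+1)·N·∏ⱼ(2·sideS₂ Sc j)`.

References: Yu. V. Nesterenko, LNM 1819 (2003) §3.3 Prop 3.4(2), §3.5, Prop 3.9 (3.48).
-/

noncomputable section

open Finset Matrix
open Literature.NumberTheory.Transcendental
open Literature.NumberTheory.Transcendental.CW77.Setup (Tau tauNorm)

namespace Summit.ABC.StewartYu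

namespace G3Setup

variable {p : ℕ} [Fact p.Prime] (S : G3Setup p) (F : S.SatData) (Sc : G3Sched S.n)

/-- **The count of the skew family**: `N·∏ⱼ(2·sⱼ) ≤ #satFam F (LcS) (svS)` when `N = |det C|`.
[cite: Nesterenko2003, §3.3 Prop 3.4(2), §3.5; shape only] -/
theorem card_satFam_ge_of_det (hdet : (F.N : ℤ) = |F.C.det|) :
    F.N * ∏ j, (2 * S.sideS₂ Sc j) ≤ (S.satFam F (S.LcS F Sc) (S.svS F Sc)).card := by
  classical
  have h := SatBox.card_satBox_ge F.N F.hN F.U F.C F.hCU (S.sideS₂ Sc) (S.LcS F Sc) (S.sum_side_mul_abs_le_LcS F Sc)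
  have hN : F.C.det.natAbs = F.N := by
    have : (F.C.det.natAbs : ℤ) = (F.N : ℤ) := by rw [Int.natCast_natAbs, hdet]
    exact_mod_cast this
  rw [hN] at h
  refine h.trans (le_of_eq ?_)
  unfold satFam box svS
  congr 1

/-- **The B1 conjunct of `IneqPackSat` from the record's count in `N·∏(2sⱼ)` form.** [cite: Nesterenko2003, Prop 3.9 (3.48); shape only] -/
theorem startCountSat_of_record (hdet : (F.N : ℤ) = |F.C.det|)
    (hrec : 2 * (Icc (-(S.NS Sc 0 0 : ℤ)) (S.NS Sc 0 0) ×ˢ tauSetR S.n S.j₀ (S.TordS Sc 0 0)).card * ((p - 1) * p ^ Sc.m) ≤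
      (Sc.L₀ + 1) * (F.N * ∏ j, (2 * S.sideS₂ Sc j))) :
    2 * (Icc (-(S.NS Sc 0 0 : ℤ)) (S.NS Sc 0 0) ×ˢ tauSetR S.n S.j₀ (S.TordS Sc 0 0)).card * ((p - 1) * p ^ Sc.m) ≤
      (Sc.L₀ + 1) * (S.satFam F (S.LcS F Sc) (S.svS F Sc)).card :=
  hrec.trans (Nat.mul_le_mul_left _ (S.card_satFam_ge_of_det F Sc hdet))

end G3Setup

end Summit.ABC.StewartYu

end
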